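import Summits.RiemannHypothesis.RiemannHypothesis.Theses.SpectralTrace
import Summits.RiemannHypothesis.RiemannHypothesis.Theorems.SpectralTraceWindowCompactness
import Summits.RiemannHypothesis.RiemannHypothesis.Theorems.SpectralTraceSpectralThesisStubClosedLadder
import Literature.NumberTheory.LFunctions.RiemannXi

/-!
# Crux `SpectralThesis` (stmt-RiemannHypothesis-0187) — line `Sketch`: the window ladder as a
continuity method (lead skeleton)

Crux (route SpectralTrace, rank 0, the thesis `X`):
`SpectralThesis : ∃ (ι : Type) (γ : ι → ℝ), ∀ g, IsWeilTest g →
   HasSum (i ↦ ĝ(1/2 + iγ_i)) (W g)` — kernel-checked equivalent to the Riemann hypothesis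
(`Cruxes/SpectralThesis/Disproof.lean`, `spectralThesis_iff_riemannHypothesis`).

The line (card `window-continuity-method`, skeleton `Cruxes/SpectralThesis/SketchIdeator2.lean`):
the set of windows `A` carrying a rung is a down-set of `(0, ∞)`; if it is non-empty (BASE), open
(OPEN: every rung extends a little) and closed under increasing limits (CLOSED), it is all of
`(0, ∞)`, which is the ladder, which is `X` (`windowCompactness_proof`, landed).

Design choice of this skeleton: rungs are typed on OPEN windows, `tsupport g ⊆ Ioo (-A) A`
(`OpenWindowRung A`). A compactly supported test inside the open window sits inside a closed
sub-window, so closedness becomes a pure vague-compactness statement about witnesses (no dilation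
`g(t/r)` and no continuity of `W` is needed), and the closed-window ladder of the route is recovered
from the open rung at `A + 1`.

Registered stubs: `stub_baseRung` (open), `stub_openLadder` (open, the lead's), `stub_closedLadder`
(CLOSED: landed p91348 as `Theorems.SpectralThesis.Sketch.stub_closedLadder`, cell-wise ultrafilter limit
of witnesses, with the uniform local Weyl bound `stub_closedLadder_cells` landed p87914).
Composition `SpectralThesis_of` and the calibration section are sorry-free.

WHERE THE CRUX LIVES (proved below, sorry-free): `RH → stub_openLadder` and
`stub_baseRung → stub_closedLadder → (stub_openLadder ↔ RH)`; the base is implied by the route item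
`WindowTraceArch` (stmt-RiemannHypothesis-11195) and the closedness is provable by compactness, so the
openness stub carries exactly the Riemann hypothesis.

REV 4 (lead gen 1, 2026-08-16): an UNCONDITIONAL CONSTRUCTION of the base rung is registered as ten
further stubs (section `BaseRung construction`), all RH-free classical analysis:
the Hermite–Biehler window trace theorem (`stub_hbContour`, `stub_hbAliasing`, `stub_hbPoisson`:
level sets `{Φ ≡ π/2 mod π}` of the phase of `E = e^{-ibz} E₀`, `E₀` Hermite–Biehler, reproduce
`(1/π) ∫ ĝ Φ'` EXACTLY for tests supported in `(-2b, 2b)` — Poisson summation, the aliasing terms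
vanish by a contour shift), the base family = two half-scale Lagarias `ξ`-fences
`E_base = e^{-ib₁z} ξ(11/4 - iz/2)²` (`stub_xiPhase`, `stub_xiFenceHB`, `stub_xiFenceTrace`: its
trace is `W(g) + (2b₁ - log 2) g(0) + ∫ g · fenceDefect`, the `-1/(2|x|)` singularities cancelling
exactly and `fenceDefect(0) = 4`), removal of the four level points `t(0), t(1), t(-1), t(-2)`
(integrality), one Hermite–Biehler LATTICE family at heights `Y + η_n` (`stub_latticePhase`,
`stub_latticeTrace`) whose height profile solves a Banach fixed point in the weighted Wiener
algebra `sup (1+n²)|η_n|` (`stub_heightFixedPoint`, fed by the germ `stub_fenceGerm`). The glue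
`baseRung_construction : BaseRung` (sorry-free from the ten stubs) is the landing route for the
registered `stub_baseRung`; the crux is then `OpenLadder` alone (= RH, p92634).
-/

noncomputable section

set_option linter.dupNamespace false

namespace Summit.RiemannHypothesis.RiemannHypothesis.Cruxes.SpectralThesis.Sketch

open Complex Set
open Literature.NumberTheory.LFunctions
open Summit.RiemannHypothesis.RiemannHypothesis.Theses.SpectralTrace
open Summit.RiemannHypothesis.RiemannHypothesis.Theorems

/-! ## Vocabulary -/

/-- `OpenWindowRung A`: some real family `γ` reproduces the Weil functional on every Weil test
supported in the OPEN window `(-A, A)`: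
`∃ ι γ, ∀ g, IsWeilTest g → tsupport g ⊆ Ioo (-A) A → HasSum (i ↦ ĝ(1/2 + iγ_i)) (W g)`. -/
def OpenWindowRung (A : ℝ) : Prop :=
  ∃ (ι : Type) (γ : ι → ℝ), ∀ g : ℝ → ℂ, IsWeilTest g → tsupport g ⊆ Set.Ioo (-A) A →
    HasSum (fun i => weilMellin g (1 / 2 + (γ i : ℂ) * I)) (weilFunctional g)

/-- Rungs are monotone: a witness for a bigger open window serves every smaller one. -/
theorem openWindowRung_mono {A A' : ℝ} (h : A ≤ A') (hA' : OpenWindowRung A') :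
    OpenWindowRung A := by
  obtain ⟨ι, γ, hγ⟩ := hA'
  exact ⟨ι, γ, fun g hg hgs => hγ g hg (hgs.trans (Ioo_subset_Ioo (by linarith) h))⟩

/-- A closed-window rung of the route (`tsupport g ⊆ Icc (-A) A`) is an open-window rung at `A`. -/
theorem openWindowRung_of_Icc {A : ℝ} {ι : Type} {γ : ι → ℝ}
    (h : ∀ g : ℝ → ℂ, IsWeilTest g → tsupport g ⊆ Set.Icc (-A) A →
      HasSum (fun i => weilMellin g (1 / 2 + (γ i : ℂ) * I)) (weilFunctional g)) :
    OpenWindowRung A :=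
  ⟨ι, γ, fun g hg hgs => h g hg (hgs.trans Ioo_subset_Icc_self)⟩

/-- An open-window rung at `A + ε` (`ε > 0`) gives the route's closed-window rung at `A`. -/
theorem Icc_rung_of_openWindowRung {A ε : ℝ} (hε : 0 < ε) (h : OpenWindowRung (A + ε)) :
    ∃ (ι : Type) (γ : ι → ℝ), ∀ g : ℝ → ℂ, IsWeilTest g → tsupport g ⊆ Set.Icc (-A) A →
      HasSum (fun i => weilMellin g (1 / 2 + (γ i : ℂ) * I)) (weilFunctional g) := by
  obtain ⟨ι, γ, hγ⟩ := h
  exact ⟨ι, γ, fun g hg hgs => hγ g hg (hgs.trans (Icc_subset_Ioo (by linarith) (by linarith)))⟩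

/-! ## The three stub STATEMENTS (named; the registered `stub_*` theorems restate them verbatim) -/

/-- BASE: some positive open window carries a rung. Prime-free (any `A₀ ≤ log 2` sees no prime
power), purely archimedean: `Σ_i e^{iγ_i x} = 2cosh(x/2) + W_∞` as distributions near `x = 0`.
Implied by the route item `WindowTraceArch` (stmt-RiemannHypothesis-11195). -/
def BaseRung : Prop :=
  ∃ A₀ : ℝ, 0 < A₀ ∧ ∃ (ι : Type) (γ : ι → ℝ), ∀ g : ℝ → ℂ, IsWeilTest g →
    tsupport g ⊆ Set.Ioo (-A₀) A₀ →
      HasSum (fun i => weilMellin g (1 / 2 + (γ i : ℂ) * I)) (weilFunctional g)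

/-- OPEN: every rung extends a little (the continuation / a-priori content of the line). -/
def OpenLadder : Prop :=
  ∀ A : ℝ, 0 < A →
    (∃ (ι : Type) (γ : ι → ℝ), ∀ g : ℝ → ℂ, IsWeilTest g → tsupport g ⊆ Set.Ioo (-A) A →
      HasSum (fun i => weilMellin g (1 / 2 + (γ i : ℂ) * I)) (weilFunctional g)) →
    ∃ ε : ℝ, 0 < ε ∧ ∃ (ι : Type) (γ : ι → ℝ), ∀ g : ℝ → ℂ, IsWeilTest g →
      tsupport g ⊆ Set.Ioo (-(A + ε)) (A + ε) →
        HasSum (fun i => weilMellin g (1 / 2 + (γ i : ℂ) * I)) (weilFunctional g)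

/-- CLOSED: rungs on every smaller open window give a rung on the limit window (vague compactness
of witnesses: uniform local Weyl bound at the fixed window `A/4`, integer counting functions,
diagonal selection, integrality of the limit, tails by the decay of `ĝ`). -/
def ClosedLadder : Prop :=
  ∀ A : ℝ, 0 < A →
    (∀ A' : ℝ, 0 < A' → A' < A → ∃ (ι : Type) (γ : ι → ℝ), ∀ g : ℝ → ℂ, IsWeilTest g →
      tsupport g ⊆ Set.Ioo (-A') A' →
        HasSum (fun i => weilMellin g (1 / 2 + (γ i : ℂ) * I)) (weilFunctional g)) →
    ∃ (ι : Type) (γ : ι → ℝ), ∀ g : ℝ → ℂ, IsWeilTest g → tsupport g ⊆ Set.Ioo (-A) A →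
      HasSum (fun i => weilMellin g (1 / 2 + (γ i : ℂ) * I)) (weilFunctional g)

/-! ## The registered stubs (`sorry` lives only in these three theorems) -/

/-- **STUB · `stub_baseRung`** (= `BaseRung` verbatim). -/
theorem stub_baseRung :
    ∃ A₀ : ℝ, 0 < A₀ ∧ ∃ (ι : Type) (γ : ι → ℝ), ∀ g : ℝ → ℂ, IsWeilTest g →
      tsupport g ⊆ Set.Ioo (-A₀) A₀ →
        HasSum (fun i => weilMellin g (1 / 2 + (γ i : ℂ) * I)) (weilFunctional g) := by
  sorry

/-- **STUB · `stub_openLadder`** (= `OpenLadder` verbatim; held by the lead — RH-strength, see the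
calibration section). -/
theorem stub_openLadder :
    ∀ A : ℝ, 0 < A →
      (∃ (ι : Type) (γ : ι → ℝ), ∀ g : ℝ → ℂ, IsWeilTest g → tsupport g ⊆ Set.Ioo (-A) A →
        HasSum (fun i => weilMellin g (1 / 2 + (γ i : ℂ) * I)) (weilFunctional g)) →
      ∃ ε : ℝ, 0 < ε ∧ ∃ (ι : Type) (γ : ι → ℝ), ∀ g : ℝ → ℂ, IsWeilTest g →
        tsupport g ⊆ Set.Ioo (-(A + ε)) (A + ε) →
          HasSum (fun i => weilMellin g (1 / 2 + (γ i : ℂ) * I)) (weilFunctional g) := by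
  sorry

/-- **STUB · `stub_closedLadder`** (= `ClosedLadder` verbatim) — CLOSED: proved in the tree
(`Theorems/SpectralTraceSpectralThesisStubClosedLadder.lean`, p91348): witnesses for `a_k ↑ A` are
closed-window families on `[-A/4, A/4]`, their cell-wise `hyperfilter` limit
(`ClosedLadder.exists_limit_family`) is a witness for the open window `(-A, A)`. -/
theorem stub_closedLadder :
    ∀ A : ℝ, 0 < A →
      (∀ A' : ℝ, 0 < A' → A' < A → ∃ (ι : Type) (γ : ι → ℝ), ∀ g : ℝ → ℂ, IsWeilTest g →
        tsupport g ⊆ Set.Ioo (-A') A' →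
          HasSum (fun i => weilMellin g (1 / 2 + (γ i : ℂ) * I)) (weilFunctional g)) →
      ∃ (ι : Type) (γ : ι → ℝ), ∀ g : ℝ → ℂ, IsWeilTest g → tsupport g ⊆ Set.Ioo (-A) A →
        HasSum (fun i => weilMellin g (1 / 2 + (γ i : ℂ) * I)) (weilFunctional g) :=
  Summit.RiemannHypothesis.RiemannHypothesis.Theorems.SpectralThesis.Sketch.stub_closedLadder

/-- **SUB-GOAL · `stub_closedLadder_cells`** (registered anchor of the auxiliary file of
`stub_closedLadder`) — CLOSED: the uniform (family-independent) local Weyl bound, landed p87914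
(`Theorems/SpectralTraceSpectralThesisClosedLadderCells.lean`). -/
theorem stub_closedLadder_cells : ∀ {B : ℝ}, 0 < B → ∃ C : ℝ, 0 < C ∧ ∀ {ι : Type} (γ : ι → ℝ),
    (∀ g : ℝ → ℂ, IsWeilTest g → tsupport g ⊆ Set.Icc (-B) B →
      HasSum (fun i => weilMellin g (1 / 2 + (γ i : ℂ) * I)) (weilFunctional g)) →
    ∀ (T : ℝ) (s : Finset ι), (∀ i ∈ s, |γ i - T| ≤ 1) →
      (s.card : ℝ) ≤ C * (1 + Real.log (1 + |T|)) :=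
  Summit.RiemannHypothesis.RiemannHypothesis.Theorems.SpectralThesis.Sketch.ClosedLadder.stub_closedLadder_cells

/-! ## BaseRung construction (rev 4): ten RH-free stubs and their glue

Conventions: `ĝ(t) = weilMellin g (1/2 + t I) = ∫ g(x) e^{ixt} dx`; `σ = 11/4` (`h = 9/4`, so that
`fenceDefect(0) = h + 7/4 = 4 ∈ 2ℕ`); lattice positions `x_n = 2πn/c`. Every stub is an `∃`/`∀`
statement over Mathlib + Literature vocabulary (no new definitions). -/

section BaseRungConstruction

open scoped Real

/-! ### The Hermite–Biehler window trace theorem, in three stubs -/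

/-- **STUB · `stub_hbContour`** (aliasing integrals vanish by a contour shift). `J` is holomorphic
on a neighbourhood of the closed upper half-plane and bounded by `1` there; `G` is a Weil test
supported in `[-(2b-ε), 2b-ε]`, so `Ĝ(z) = ∫ G(y)e^{iyz} dy` is entire with
`|Ĝ(x+iη)| ≤ e^{(2b-ε)η}(‖G‖₁+‖G''‖₁)/(1+x²)` for `η ≥ 0` (tree: `PaleyWienerSchwartzBounded`);
the integrand `Ĝ(z) (e^{2ibz} J(z))^n` is `O(e^{-εη}/(1+x²))` on the closed upper half-plane for
`n ≥ 1`, so its integral over `ℝ` vanishes (tree: `HalfPlaneCauchy.integral_eq_zero_of_decay`). -/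
theorem stub_hbContour {b ε : ℝ} (hb : 0 < b) (hε : 0 < ε) {J : ℂ → ℂ}
    (hJd : ∀ z : ℂ, 0 ≤ z.im → DifferentiableAt ℂ J z)
    (hJb : ∀ z : ℂ, 0 ≤ z.im → ‖J z‖ ≤ 1)
    {n : ℕ} (hn : 1 ≤ n) {G : ℝ → ℂ} (hG : IsWeilTest G)
    (hGs : tsupport G ⊆ Set.Icc (-(2 * b - ε)) (2 * b - ε)) :
    ∫ x : ℝ, weilMellin G (1 / 2 + x * I) * (Complex.exp (2 * I * b * x) * J x) ^ n = 0 := by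
  sorry

/-- **STUB · `stub_hbAliasing`** (integration by parts + reflection bookkeeping). With
`e^{2iΦ(x)} = e^{2ibx} J(x)` on `ℝ`: `∫ ĝ Φ' e^{-2inΦ} = (1/2in) ∫ (ĝ)' e^{-2inΦ}`,
`(ĝ)' = FT(iy·g)` is again a Weil test in the window, `e^{-2inΦ} = (e^{2ibx}J)^{|n|}` for `n < 0`
and `= conj((e^{2ibx}J)^n)` for `n > 0` (then conjugate and use `weilReflect`), so every aliasing
integral is one of the contour integrals of `stub_hbContour` (given here as the hypothesis
`hcontour`). -/
theorem stub_hbAliasing {b : ℝ} (hb : 0 < b) {Φ : ℝ → ℝ} {J : ℂ → ℂ}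
    (hΦ : ContDiff ℝ 1 Φ) (hΦb : ∀ x, b ≤ deriv Φ x)
    (hΦg : ∃ C : ℝ, ∀ x, deriv Φ x ≤ C * (1 + Real.log (1 + |x|)))
    (hJt : ∀ x : ℝ, J x = Complex.exp (2 * I * (Φ x - b * x)))
    (hcontour : ∀ n : ℕ, 1 ≤ n → ∀ G : ℝ → ℂ, IsWeilTest G →
      (∃ ε : ℝ, 0 < ε ∧ tsupport G ⊆ Set.Icc (-(2 * b - ε)) (2 * b - ε)) →
        ∫ x : ℝ, weilMellin G (1 / 2 + x * I) * (Complex.exp (2 * I * b * x) * J x) ^ n = 0)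
    {g : ℝ → ℂ} (hg : IsWeilTest g) (hgs : tsupport g ⊆ Set.Ioo (-(2 * b)) (2 * b))
    {n : ℤ} (hn : n ≠ 0) :
    ∫ x : ℝ, weilMellin g (1 / 2 + x * I) * ((deriv Φ x : ℝ) : ℂ) * Complex.exp (-(2 * I * n * Φ x)) = 0 := by
  sorry

/-- **STUB · `stub_hbPoisson`** (Poisson summation in the phase variable). `Φ ∈ C¹`,
`Φ' ≥ b > 0`, `Φ' ≤ C(1 + log(1+|x|))`, `t` is the level sequence `Φ(t_m) = π(m + 1/2)`. With
`f(u) := ĝ(Φ⁻¹(π(u + 1/2)))` (continuous, `O(|u|^{-3/2})` since `|ĝ(x)| ≤ D/(1+x²)` and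
`|Φ(x)| ≤ |Φ(0)| + C|x|(1 + log(1+|x|))`), Mathlib's
`Real.tsum_eq_tsum_fourier_of_rpow_decay_of_summable` gives `Σ_m f(m) = Σ_n 𝓕f(n)`, and the
change of variables `u = Φ(x)/π - 1/2` gives `𝓕f(n) = ((-1)^n/π) ∫ ĝ Φ' e^{-2inΦ}`, which is
`(1/π)∫ ĝ Φ'` for `n = 0` and vanishes for `n ≠ 0` by `halias`. -/
theorem stub_hbPoisson {b : ℝ} (hb : 0 < b) {Φ : ℝ → ℝ} (hΦ : ContDiff ℝ 1 Φ)
    (hΦb : ∀ x, b ≤ deriv Φ x) (hΦg : ∃ C : ℝ, ∀ x, deriv Φ x ≤ C * (1 + Real.log (1 + |x|)))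
    {t : ℤ → ℝ} (ht : ∀ m : ℤ, Φ (t m) = π * (m + 1 / 2))
    {g : ℝ → ℂ} (hg : IsWeilTest g)
    (halias : ∀ n : ℤ, n ≠ 0 →
      ∫ x : ℝ, weilMellin g (1 / 2 + x * I) * ((deriv Φ x : ℝ) : ℂ) * Complex.exp (-(2 * I * n * Φ x)) = 0) :
    HasSum (fun m : ℤ => weilMellin g (1 / 2 + (t m : ℂ) * I))
      ((1 / π : ℂ) * ∫ x : ℝ, weilMellin g (1 / 2 + x * I) * ((deriv Φ x : ℝ) : ℂ)) := by
  sorry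

/-! ### The base family: two half-scale Lagarias `ξ`-fences on `Re s = 11/4` -/

/-- **STUB · `stub_xiPhase`** (continuous argument of `ξ` on the line `Re s = 11/4`).
`θ(t) := ∫₀ᵗ Re (ξ'/ξ)(11/4 + is) ds` is `C¹` with `θ' = Re ξ'/ξ > 0`
(`re_logDeriv_riemannXi_pos_of_one_le_re`), `θ' ≤ C(1 + log(1+|t|))` (vertical bounds of
`RiemannXiLogDeriv`/Stirling), and `ξ(11/4+it) = |ξ(11/4+it)| e^{iθ(t)}` (integrate the logarithmic
derivative along the vertical ray, as `riemannXi_eq_mul_exp_integral_logDeriv` does horizontally;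
`ξ(11/4) > 0`). -/
theorem stub_xiPhase :
    ∃ θ : ℝ → ℝ, ContDiff ℝ 1 θ ∧ θ 0 = 0 ∧
      (∀ t : ℝ, deriv θ t = (logDeriv riemannXi ((11 / 4 : ℂ) + t * I)).re) ∧
      (∀ t : ℝ, riemannXi ((11 / 4 : ℂ) + t * I) =
        (‖riemannXi ((11 / 4 : ℂ) + t * I)‖ : ℂ) * Complex.exp (θ t * I)) ∧
      (∀ t : ℝ, 0 < deriv θ t) ∧
      ∃ C : ℝ, ∀ t : ℝ, deriv θ t ≤ C * (1 + Real.log (1 + |t|)) := by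
  sorry

/-- **STUB · `stub_xiFenceHB`** (the squared half-scale fence is a bounded holomorphic inner datum).
`J(z) = ξ(11/4 + iz/2)² / ξ(11/4 − iz/2)²`: the denominator does not vanish for `Im z ≥ 0`
(`Re(11/4 − iz/2) = 11/4 + Im z/2 ≥ 1`, `riemannXi_ne_zero_of_one_le_re`), and `|J| ≤ 1` there by
Lagarias 2005 Lemma 2.1 (PROVED: `lagarias2005_lemma_2_1_holds`, `.structureFunction` with `h = 9/4`
at `w = z/2`) and Schwarz reflection `riemannXi_conj_holds`. -/
theorem stub_xiFenceHB :
    (∀ z : ℂ, 0 ≤ z.im → DifferentiableAt ℂ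
        (fun w : ℂ => riemannXi (11 / 4 + I * w / 2) ^ 2 / riemannXi (11 / 4 - I * w / 2) ^ 2) z) ∧
    (∀ z : ℂ, 0 ≤ z.im →
        ‖riemannXi (11 / 4 + I * z / 2) ^ 2 / riemannXi (11 / 4 - I * z / 2) ^ 2‖ ≤ 1) := by
  sorry

/-- **STUB · `stub_xiFenceTrace`** (the trace density of the half-scale fence, evaluated: "the
explicit formula on the line `Re s = 11/4`"). For a Weil test `g` supported in
`(-(log 2)/2, (log 2)/2)`:
`(1/π) ∫ ĝ(t) Re(ξ'/ξ)(11/4 + it/2) dt = W(g) − (log 2) g(0) + ∫ g · fenceDefect`, where, with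
`ξ'/ξ(s) = 1/s + 1/(s−1) − (log π)/2 + ψ(s/2)/2 + ζ'/ζ(s)` (`logDeriv_riemannXi_eq_of_one_lt_re`):
the prime part vanishes (`integral_weilMellin_vertical_mul_natCast_cpow`: it sees `g(±(log n)/2) = 0`),
the polar parts give `2∫ g (e^{-(11/2)|x|} + e^{-(7/2)|x|})` (`integral_weilMellin_vertical_div_sub`),
`-(log π)/2` gives `-(log π) g(0)` (`integral_weilMellin_vertical`), and the digamma part in Gauss'
form at `(a, b) = (11/8, 1/4)` is `-γ g(0) − ∫₀^∞ (2e^{-(11/2)t}(g(t)+g(-t)) − 4e^{-4t}g(0))/(1−e^{-4t}) dt`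
(as `weilArchTermBombieri_eq_weilArchTerm_holds` does at `(1/4, 1/2)`); against
`W = ĝ(0)+ĝ(1) + W_arch − (log π)g(0)` (no primes on this support) the `g(0)`-regularisers differ by
`g(0)∫₀^∞ (4e^{-4t}/(1−e^{-4t}) − 2e^{-2t}/(1−e^{-2t})) dt = −(log 2) g(0)`. The integrand is written
for `x ≠ 0` (at `x = 0` the two quotients take Lean's junk value `x/0 = 0`; a null set). -/
theorem stub_xiFenceTrace {g : ℝ → ℂ} (hg : IsWeilTest g)
    (hgs : tsupport g ⊆ Set.Ioo (-(Real.log 2 / 2)) (Real.log 2 / 2)) :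
    (1 / π : ℂ) * ∫ t : ℝ, weilMellin g (1 / 2 + t * I) *
        ((logDeriv riemannXi ((11 / 4 : ℂ) + t / 2 * I)).re : ℂ)
      = weilFunctional g - Real.log 2 * g 0
        + ∫ x : ℝ, g x * ((2 * Real.exp (-(11 / 2) * |x|) + 2 * Real.exp (-(7 / 2) * |x|)
            - Real.exp (x / 2) - Real.exp (-x / 2)
            - 2 * Real.exp (-(11 / 2) * |x|) / (1 - Real.exp (-4 * |x|))
            + Real.exp (-|x| / 2) / (1 - Real.exp (-2 * |x|)) : ℝ) : ℂ) := by
  sorry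

/-- **STUB · `stub_fenceGerm`** (the germ at `0` of the corrected defect is smooth after division by
`x`). With `m(x)` the `fenceDefect` above (`x > 0`), `m(0+) = 4` and `m'(0+) = -83/4`
(`= -(h² + 7h - 1/16)` at `h = 9/4`): the two quotients have simple poles at `0` with residues
`∓1/2` that cancel, so `m` is real-analytic on `[0, ∞)`; hence for any `Y, r₁, r₂` the function
`e^{Yx}(m(x) − 2cos r₁x − 2cos r₂x)/x` extends to a `C²` (indeed analytic) function `pp` on `ℝ` with
`pp(0) = m'(0+) = -83/4`. (Tools: `HasFPowerSeriesAt.has_fpower_series_dslope_fslope`, or the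
Hadamard quotient `∫₀¹ q'(sx) ds`.) -/
theorem stub_fenceGerm (Y r₁ r₂ : ℝ) :
    ∃ pp : ℝ → ℝ, ContDiff ℝ 2 pp ∧ pp 0 = -(83 / 4) ∧
      ∀ x : ℝ, 0 < x → x ≤ 1 →
        x * pp x = Real.exp (Y * x) *
          (2 * Real.exp (-(11 / 2) * x) + 2 * Real.exp (-(7 / 2) * x) - Real.exp (x / 2) - Real.exp (-x / 2)
            - 2 * Real.exp (-(11 / 2) * x) / (1 - Real.exp (-4 * x))
            + Real.exp (-x / 2) / (1 - Real.exp (-2 * x))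
            - 2 * Real.cos (r₁ * x) - 2 * Real.cos (r₂ * x)) := by
  sorry

/-! ### The correcting lattice family -/

/-- **STUB · `stub_latticePhase`** (Hermite–Biehler data of a lattice configuration). For heights
`y_n ∈ [Y₁, Y₂]`, `Y₁ > 0`, at the lattice positions `x_n = 2πn/c`: the phase
`Φ(t) = b_R t + Σ_n (arctan((t − x_n)/y_n) + arctan(x_n/y_n))` is `C¹` with
`Φ' = b_R + Σ_n y_n/((t−x_n)² + y_n²) ∈ [b_R, b_R + C]` (`hasDerivAt_tsum`), and the Blaschke-type
product `J(z) = Π_n (1 − z/w_n)/(1 − z/w̄_n)`, `w_n = x_n + i y_n` (factors `1 + O(|z|/x_n²)`, locally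
uniformly convergent on `Im z > -Y₁`), is holomorphic there, bounded by `1` on `Im z ≥ 0` (termwise),
and equals `e^{2i(Φ(t) − b_R t)}` on `ℝ` (termwise: `e^{2i arctan((t−x_n)/y_n)} e^{2i arctan(x_n/y_n)}
= (w̄_n/w_n)(w_n − t)/(w̄_n − t)` exactly). -/
theorem stub_latticePhase {c bR Y₁ Y₂ : ℝ} (hc : 0 < c) (hbR : 0 < bR) (hY₁ : 0 < Y₁) (hY₁₂ : Y₁ ≤ Y₂)
    (y : ℤ → ℝ) (hy : ∀ n : ℤ, Y₁ ≤ y n ∧ y n ≤ Y₂) :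
    ∃ (Φ : ℝ → ℝ) (J : ℂ → ℂ), ContDiff ℝ 1 Φ ∧
      (∀ t : ℝ, HasSum (fun n : ℤ => y n / ((t - 2 * π * n / c) ^ 2 + (y n) ^ 2)) (deriv Φ t - bR)) ∧
      (∀ t : ℝ, bR ≤ deriv Φ t) ∧ (∃ C : ℝ, ∀ t : ℝ, deriv Φ t ≤ C) ∧
      (∀ z : ℂ, 0 ≤ z.im → DifferentiableAt ℂ J z) ∧ (∀ z : ℂ, 0 ≤ z.im → ‖J z‖ ≤ 1) ∧
      (∀ t : ℝ, J t = Complex.exp (2 * I * (Φ t - bR * t))) := by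
  sorry

/-- **STUB · `stub_latticeTrace`** (trace density of the lattice family, evaluated). With heights
`y_n ≥ Y₁ > 0`, `Σ_n |y_n − Y| < ∞` and `D = Σ_n y_n/((t−x_n)²+y_n²)`:
`(1/π)∫ ĝ D = Σ_n ∫ g(x) e^{i x_n x − y_n|x|} dx` (Tonelli; per term the Poisson-kernel/Fourier pair
`(1/π)∫ ĝ(t) y/((t−x₀)²+y²) dt = ∫ g(x) e^{ix₀x − y|x|} dx`), then split `e^{-y_n|x|} = e^{-Y|x|} +
(e^{-y_n|x|} − e^{-Y|x|})`: the second part is absolutely summable (`|·| ≤ |y_n − Y||x|`) and gives the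
integral of `g` against the `tsum`; the first is `Σ_n (g e^{-Y|·|})^(2πn/c) = c Σ_k (g e^{-Y|·|})(kc)
= c g(0)` by Poisson summation (`Real.tsum_eq_tsum_fourier_of_rpow_decay_of_summable` for
`u ↦ c (g e^{-Y|·|})(cu)`, whose Fourier transform is `O(1/n²)` by two integrations by parts with one
corner), only `k = 0` meeting the support `(-c/2, c/2)`. -/
theorem stub_latticeTrace {c Y Y₁ : ℝ} (hc : 0 < c) (hY : 0 < Y) (hY₁ : 0 < Y₁) (y : ℤ → ℝ)
    (hy : ∀ n : ℤ, Y₁ ≤ y n) (hys : Summable fun n : ℤ => |y n - Y|)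
    {g : ℝ → ℂ} (hg : IsWeilTest g) (hgs : tsupport g ⊆ Set.Ioo (-(c / 2)) (c / 2))
    {D : ℝ → ℝ} (hD : ∀ t : ℝ, HasSum (fun n : ℤ => y n / ((t - 2 * π * n / c) ^ 2 + (y n) ^ 2)) (D t)) :
    (1 / π : ℂ) * ∫ t : ℝ, weilMellin g (1 / 2 + t * I) * (D t : ℂ)
      = c * g 0 + ∫ x : ℝ, g x *
          ∑' n : ℤ, Complex.exp (2 * π * n / c * x * I) *
            ((Real.exp (-(y n) * |x|) - Real.exp (-Y * |x|) : ℝ) : ℂ) := by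
  sorry

/-- **STUB · `stub_heightFixedPoint`** (the height profile: a Banach fixed point in a weighted Wiener
algebra). For an even continuous `p`, `C²` on `[0, 1]` (one-sided), and all small periods `c`: there
are even real coefficients `η_n = O(1/n²)` with
`Σ_n e^{2πinx/c} (e^{-η_n|x|} − 1) = −|x| p(x)` on the whole period `|x| ≤ c/2`.
Proof sketch: in `S = {η : sup (1+n²)|η_n| < ∞}` (≅ ℓ^∞, complete; a Banach algebra under the
Cauchy product with constant `C_S`, and `η ↦ η^k` coefficientwise is `1`-Lipschitz-like), expand
`e^{-η_n|x|} − 1 = Σ_{k≥1} (−|x|)^k η_n^k/k!`, so the equation reads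
`H = P + Σ_{k≥2} (−1)^k Λ^{k−1} H_k / k!` with `H = Σ η_n e_n`, `H_k = Σ η_n^k e_n`, `P` = the
`c`-periodisation of `p|[-c/2,c/2]` (coefficients: `|P₀| ≤ sup|p|`, `(1+n²)|P_n| ≤ (2c/π²)(|p'(0+)| +
|p'(c/2)| + c sup|p''|/2)` by two integrations by parts) and `Λ` = the triangle wave `|x|`
(`Λ_n = c((−1)^n − 1)/(2π²n²)`, `Λ₀ = c/4`); the map is a contraction on the ball of radius `1` about
`P` once `C_S ‖Λ‖_S (‖P‖_S + 1) e^{…} < 1/2`, i.e. for `c ≤ c₀(p)`; pointwise identities from absolute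
convergence (`hasSum_fourier_series_of_summable`-type lemmas on `AddCircle c`). -/
theorem stub_heightFixedPoint (p : ℝ → ℝ) (hp_even : ∀ x, p (-x) = p x) (hp_cont : Continuous p)
    (hp_smooth : ∃ pp : ℝ → ℝ, ContDiff ℝ 2 pp ∧ ∀ x : ℝ, 0 ≤ x → x ≤ 1 → p x = pp x) :
    ∃ c₀ : ℝ, 0 < c₀ ∧ c₀ ≤ 1 ∧ ∀ c : ℝ, 0 < c → c ≤ c₀ →
      ∃ η : ℤ → ℝ, (∀ n : ℤ, η (-n) = η n) ∧
        (∀ n : ℤ, |η n| ≤ (|p 0| + 1) / (1 + (n : ℝ) ^ 2)) ∧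
        ∀ x : ℝ, |x| ≤ c / 2 →
          HasSum (fun n : ℤ => Complex.exp (2 * π * n / c * x * I) *
              ((Real.exp (-(η n) * |x|) - 1 : ℝ) : ℂ))
            ((-(|x| * p x) : ℝ) : ℂ) := by
  sorry

end BaseRungConstruction

/-! ### Consistency: each named statement IS its registered stub (definitionally) -/

theorem baseRung_holds : BaseRung := stub_baseRung
theorem openLadder_holds : OpenLadder := stub_openLadder
theorem closedLadder_holds : ClosedLadder := stub_closedLadder

/-! ### Name-keyed aliases of the three statements (the hypotheses of the composition) -/
namespace Registered

/-- Alias of `BaseRung` keyed by the registered stub name. -/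
abbrev stub_baseRung : Prop := BaseRung
/-- Alias of `OpenLadder` keyed by the registered stub name. -/
abbrev stub_openLadder : Prop := OpenLadder
/-- Alias of `ClosedLadder` keyed by the registered stub name. -/
abbrev stub_closedLadder : Prop := ClosedLadder

end Registered

/-! ## Proved glue: the continuity method on `(0, ∞)` (pure order theory of `ℝ`) -/

/-- **Continuity method on the window parameter.** A monotone (down-closed) property of positive
reals which holds somewhere, extends a little from every point, and passes to increasing limits,
holds everywhere on `(0, ∞)`. -/
theorem forall_of_continuity {P : ℝ → Prop} (mono : ∀ {x y : ℝ}, x ≤ y → P y → P x)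
    (base : ∃ A₀ : ℝ, 0 < A₀ ∧ P A₀) (opn : ∀ A : ℝ, 0 < A → P A → ∃ ε : ℝ, 0 < ε ∧ P (A + ε))
    (cls : ∀ A : ℝ, 0 < A → (∀ A' : ℝ, 0 < A' → A' < A → P A') → P A) :
    ∀ A : ℝ, 0 < A → P A := by
  intro A hA
  by_contra hnot
  obtain ⟨A₀, hA₀, hP₀⟩ := base
  set S : Set ℝ := {x | 0 < x ∧ P x} with hS
  have hmem₀ : A₀ ∈ S := ⟨hA₀, hP₀⟩
  have hne : S.Nonempty := ⟨A₀, hmem₀⟩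
  have hbdd : ∀ x ∈ S, x ≤ A := by
    intro x hx
    by_contra hxA
    push Not at hxA
    exact hnot (mono hxA.le hx.2)
  have hBdd : BddAbove S := ⟨A, hbdd⟩
  have hs_pos : 0 < sSup S := lt_of_lt_of_le hA₀ (le_csSup hBdd hmem₀)
  have hPs : P (sSup S) := by
    refine cls (sSup S) hs_pos ?_
    intro A' _ hA'lt
    obtain ⟨x, hxS, hA'x⟩ := exists_lt_of_lt_csSup hne hA'lt
    exact mono hA'x.le hxS.2
  obtain ⟨ε, hε, hPε⟩ := opn (sSup S) hs_pos hPs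
  have hle : sSup S + ε ≤ sSup S := le_csSup hBdd ⟨by linarith, hPε⟩
  linarith

/-- Every open window carries a rung, from the three statements. -/
theorem forall_openWindowRung (hB : BaseRung) (hO : OpenLadder) (hC : ClosedLadder) :
    ∀ A : ℝ, 0 < A → OpenWindowRung A :=
  forall_of_continuity (P := OpenWindowRung) (fun hxy hy => openWindowRung_mono hxy hy) hB hO hC

/-- The route's closed-window ladder `∀ A > 0, Trace(A)`, from the three statements. -/
theorem ladder_of_stubs (hB : BaseRung) (hO : OpenLadder) (hC : ClosedLadder) :
    ∀ A : ℝ, 0 < A → ∃ (ι : Type) (γ : ι → ℝ), ∀ g : ℝ → ℂ, IsWeilTest g →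
      tsupport g ⊆ Set.Icc (-A) A →
        HasSum (fun i => weilMellin g (1 / 2 + (γ i : ℂ) * I)) (weilFunctional g) :=
  fun A hA => Icc_rung_of_openWindowRung one_pos (forall_openWindowRung hB hO hC (A + 1) (by linarith))

/-! ## The composition: the three stubs imply the crux, BY NAME (kernel-checked; no `sorry` below) -/

/-- **`SpectralThesis_of`** — the glue of the line: base + openness (the two OPEN stubs) with the
landed closedness (`closedLadder_holds`) give every open rung (`forall_of_continuity`), hence the
closed-window ladder (`ladder_of_stubs`), hence `X` by the landed `windowCompactness_proof`. -/
theorem SpectralThesis_of (hB : Registered.stub_baseRung) (hO : Registered.stub_openLadder) :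
    Summit.RiemannHypothesis.RiemannHypothesis.Theses.SpectralTrace.SpectralThesis := by
  unfold SpectralThesis
  exact windowCompactness_proof (ladder_of_stubs hB hO closedLadder_holds)

/-- Wiring check: the registered (open) stubs feed `SpectralThesis_of` as stated; closedness is
discharged inside by the landed theorem. -/
example : Summit.RiemannHypothesis.RiemannHypothesis.Theses.SpectralTrace.SpectralThesis :=
  SpectralThesis_of stub_baseRung stub_openLadder

/-! ## Calibration (sorry-free): where the Riemann hypothesis sits in this line -/

/-- `X` gives every open rung (restrict a global witness). -/
theorem forall_openWindowRung_of_spectralThesis (h : SpectralThesis) :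
    ∀ A : ℝ, 0 < A → OpenWindowRung A := by
  obtain ⟨ι, γ, hγ⟩ := h
  exact fun A _ => ⟨ι, γ, fun g hg _ => hγ g hg⟩

/-- The Riemann hypothesis gives every open rung (the zero ordinates, `spectralThesis_of_riemannHypothesis`). -/
theorem forall_openWindowRung_of_riemannHypothesis (h : _root_.RiemannHypothesis) :
    ∀ A : ℝ, 0 < A → OpenWindowRung A :=
  forall_openWindowRung_of_spectralThesis (spectralThesis_of_riemannHypothesis h)

/-- Every open rung gives the Riemann hypothesis (closed ladder from the open rungs at `A + 1`, then
`riemannHypothesis_of_ladder`: Bochner form + Yoshida's form of Weil's criterion). -/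
theorem riemannHypothesis_of_forall_openWindowRung (h : ∀ A : ℝ, 0 < A → OpenWindowRung A) :
    _root_.RiemannHypothesis :=
  riemannHypothesis_of_ladder fun A hA => Icc_rung_of_openWindowRung one_pos (h (A + 1) (by linarith))

/-- **`X ↔` every open window carries a rung.** -/
theorem spectralThesis_iff_forall_openWindowRung :
    SpectralThesis ↔ ∀ A : ℝ, 0 < A → OpenWindowRung A :=
  ⟨forall_openWindowRung_of_spectralThesis,
    fun h => spectralThesis_of_riemannHypothesis (riemannHypothesis_of_forall_openWindowRung h)⟩

/-- RH proves the BASE (any window, e.g. `A₀ = 1`). -/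
theorem baseRung_of_riemannHypothesis (h : _root_.RiemannHypothesis) : BaseRung :=
  ⟨1, one_pos, forall_openWindowRung_of_riemannHypothesis h 1 one_pos⟩

/-- RH proves OPENNESS (every rung holds, so every rung extends, by `1`). -/
theorem openLadder_of_riemannHypothesis (h : _root_.RiemannHypothesis) : OpenLadder :=
  fun A hA _ => ⟨1, one_pos, forall_openWindowRung_of_riemannHypothesis h (A + 1) (by linarith)⟩

/-- RH proves CLOSEDNESS (trivially: the conclusion holds outright). -/
theorem closedLadder_of_riemannHypothesis (h : _root_.RiemannHypothesis) : ClosedLadder :=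
  fun A hA _ => forall_openWindowRung_of_riemannHypothesis h A hA

/-- The three statements prove RH. -/
theorem riemannHypothesis_of_stubs (hB : BaseRung) (hO : OpenLadder) (hC : ClosedLadder) :
    _root_.RiemannHypothesis :=
  riemannHypothesis_of_forall_openWindowRung (forall_openWindowRung hB hO hC)

/-- **Where the crux lives.** Given the base (implied by the route item `WindowTraceArch`) and the
closedness (provable by compactness), the openness stub is EQUIVALENT to the Riemann hypothesis. -/
theorem openLadder_iff_riemannHypothesis (hB : BaseRung) (hC : ClosedLadder) :
    OpenLadder ↔ _root_.RiemannHypothesis :=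
  ⟨fun hO => riemannHypothesis_of_stubs hB hO hC, openLadder_of_riemannHypothesis⟩

/-- The conjunction of the three stubs is equivalent to the crux (the split loses nothing). -/
theorem stubs_iff_spectralThesis : (BaseRung ∧ OpenLadder ∧ ClosedLadder) ↔ SpectralThesis :=
  ⟨fun ⟨hB, hO, _⟩ => SpectralThesis_of hB hO, fun h =>
    have hRH := riemannHypothesis_of_forall_openWindowRung (forall_openWindowRung_of_spectralThesis h)
    ⟨baseRung_of_riemannHypothesis hRH, openLadder_of_riemannHypothesis hRH,
      closedLadder_of_riemannHypothesis hRH⟩⟩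

/-- The route item `WindowTraceArch` (stmt-RiemannHypothesis-11195, the closed window `[-log 2, log 2]`)
implies the BASE. -/
theorem baseRung_of_windowTraceArch (h : WindowTraceArch) : BaseRung := by
  obtain ⟨ι, γ, hγ⟩ := h
  exact ⟨Real.log 2, Real.log_pos one_lt_two, ι, γ,
    fun g hg hgs => hγ g hg (hgs.trans Ioo_subset_Icc_self)⟩

end Summit.RiemannHypothesis.RiemannHypothesis.Cruxes.SpectralThesis.Sketch

end
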